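import Summits.Ventures.GridStability.Lyapunov.GroundedLaplacianSMatCert
import HarnessLib

/-!
# GroundedLaplacianD1Cert — T-L2b instance: SPARSE clique-sum certificate of a grounded Laplacian (G2-SCALE λ-certificate lane, size instrument)

Venture GRIDFUSION, G2-SCALE cell (lead g19 D13/D25), seat gridfusion-sos-5 (g9); generator
`HOME/cert/sos-5/t2b/grounded_cert.py` (mode exact). GRAPH: GrossEtAl2019 D1 three-inverter dVOC network: weights `1/ℓ_jk` for the line lengths `ℓ = 125, 25, 25 km` = the off-diagonal data of `Bench.DVOC3GCBD19Cond2.Lhat` (`L = W·L̂`; `λ₂(L̂) = 7/125` CERTIFIED there densely by the eigenbasis — this file is the v1 VALIDATION of the sparse grounded lane against it: `λ_min(L̂_g)` for `g` = node 3 is `1/25` (sup found 0.04), so the grounded lane certifies `≈ 0.70·λ₂` on D1 = the interlacing loss of record). `N = 3` nodes, grounded node `g = 2`, `m = 2`;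
`λ = 2569/65536` (sup of feasible λ by 44-step bisection on exact pivot positivity = 0.04, backed off 2 % and truncated to k/2^20). ELIMINATION (in the generator, not in Lean): natural order on the grounded index set
(= leaves-first), max block size 2 = NO fill, `2` clique blocks `[[S_ii, bᵀ], [b, C_i]]`, mode «exact» (exact rank-one Schur complements; heights grow with elimination depth);
block-entry heights: max 65 bits / 21 decimal digits, total 200 bits; certificate literals 21 (weights 6 pairs, block rationals 4,
block members 3); target nnz 4. CERTIFIED (kernel, this file): columns in range (`colsBelow`), symmetry of the weights (ONE
`SMat.eqCheck` against the radix transpose), the clique-sum identity of the rows COMPUTED in the kernel by `groundedSMatIn`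
(ONE `cliqueSweepS` decide), every block PSD (ONE `ldlAll` decide, in-kernel exact `LDLᵀ`), hence
`∀ z, λ·pairNormSq z ≤ N·½ΣΣ wᵢⱼ(zᵢ − zⱼ)²` for the weights `w = matrixOfSparseRows N N W`
(`connectivity_certificate_of_grounded_smatIn`). VALIDATED: nothing. MODELLED: the graph/weights as labelled above.
[folklore]
-/

namespace Summit.Ventures.GridStability.Bench.GroundedLaplacianD1Cert

open Literature.Computation.Certificates Literature.Computation.Certificates.PSD
open Literature.MathematicalPhysics.PowerSystems Summit.Ventures.GridStability.Lyapunov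

/-- Weight rows 0…2 of the sparse weight matrix (node ↦ (neighbour, weight) pairs). [folklore] -/
def W0 : SMat ℚ :=
  [[(1, ((1 : ℚ) / 125)), (2, ((1 : ℚ) / 25))],
   [(0, ((1 : ℚ) / 125)), (2, ((1 : ℚ) / 25))],
   [(0, ((1 : ℚ) / 25)), (1, ((1 : ℚ) / 25))]]

/-- The sparse weight matrix `W` (`3` rows, `6` stored pairs); the weights are `matrixOfSparseRows 3 3 W`. [folklore] -/
def W : SMat ℚ := W0

/-- The grounded node. [folklore] -/
def g : Fin 3 := ⟨2, by decide⟩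

/-- The certified `λ`. [folklore] -/
def lam : ℚ := ((2569 : ℚ) / 65536)

/-- Clique blocks 0…1 of the certificate (`[[S_ii, bᵀ], [b, C_i]]` on members `{i} ∪ col(i)`). [folklore] -/
def B0 : List (Block 2 ℚ) :=
  [blk2 0 1 ((72091 : ℚ) / 8192000) ((-1 : ℚ) / 125) ((65536 : ℚ) / 9011375),
   blk1 1 ((180428997 : ℚ) / 118113894400)]

/-- CERTIFICATE: all `2` clique blocks. [folklore] -/
def blocks : List (Block 2 ℚ) := B0

/-- Every stored column index is a node (`< 3`). [folklore] -/
theorem cols : colsBelow 3 W = true := by decide +kernel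

/-- The weights are symmetric: ONE sparse check against the radix transpose (`d = 2`). [folklore] -/
theorem symm : SMat.eqCheck 3 W (SMat.transpose 2 3 W) = true := by decide +kernel

/-- The clique-sum identity `L_g − λI = Σ_c P_cᵀ S_c P_c` for the rows COMPUTED by `groundedSMat` (ONE row-streamed decide). [folklore] -/
theorem sweep : cliqueSweepS 2 0 2 (groundedSMatIn 2 W 2 lam) blocks = true := by decide +kernel

/-- Every clique block is PSD (ONE decide, in-kernel exact `LDLᵀ` per block). [folklore] -/
theorem ldl : ldlAll blocks = true := by decide +kernel

/-- **CERTIFIED CONNECTIVITY CONSTANT** `λ = 2569/65536` for this graph: `∀ z, λ·‖Hz‖₂² ≤ 3·½ΣΣ wᵢⱼ(zᵢ − zⱼ)²` — the `hlam`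
hypothesis of the dVOC Condition-2 / droop / Kuramoto chains, from the SPARSE grounded certificate. [folklore] -/
theorem connectivity_certificate :
    ∀ z : Fin 3 → ℝ, (lam : ℝ) * pairNormSq z
      ≤ ((2 + 1 : ℕ) : ℝ) * (1 / 2 * ∑ i, ∑ j, ((matrixOfSparseRows 3 3 W i j : ℚ) : ℝ) * (z i - z j) ^ 2) :=
  connectivity_certificate_of_grounded_smatIn (d := 2) W (by norm_num) cols symm g lam (by norm_num [lam]) blocks sweep ldl

end Summit.Ventures.GridStability.Bench.GroundedLaplacianD1Cert
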